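import Summits.HodgeConjecture.HodgeConjecture.Theorems.NikulinTwinTransportRealMultiplicationCore
import Summits.HodgeConjecture.HodgeConjecture.Theorems.NikulinTwinTransportRealMultiplicationGForm
import Literature.AlgebraicGeometry.Surfaces.K3MarkingProofs

/-!
# Route NikulinTwinTransport · `RealMultiplicationGlue` (stmt-HodgeConjecture-13681) —
# the rational `2`-self-similitude of `H²(S)` from the numerical invariants `b₂ = 22`, even, `τ = −16`

Helper file (supports stmt-HodgeConjecture-13681). The marking-free glue
(`realMultiplicationGlue_of_twoSelfSimilar`, sibling file
`NikulinTwinTransportRealMultiplicationGlueOfTwoSelfSimilar`) needs, for every projective K3 surface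
`S`, one `ℂ`-linear endomorphism `Ξ` of `H²(S(ℂ); ℂ)` preserving rational classes with
`(Ξx ∪ Ξy) = 2 (x ∪ y)` ("`H²(S, ℚ)(2) ≅ H²(S, ℚ)`"). `k3TwoSelfSimilar_of_marking` derives it from
the marking fact `Huybrechts_K3_marking_exists`. This file shows that the PURELY TOPOLOGICAL part
of that fact suffices — Huybrechts, *Lectures on K3 Surfaces*, Ch. 1 Prop. 3.5 proper and its
printed proof (p. 24): `b₂ = 22`, the intersection form is even, of index `−16` — with no Hodge
datum, no period point and no positivity:

* `integralMarking_of_basis` — the coordinate isomorphism `η`, the generator `p` of `H⁴` and the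
  two marking clauses (integral classes `= η⁻¹(ℤ^ι)`, `a ∪ b = ((ηa)ᵀ G (ηb)) p`) from ANY integral
  basis of `H²(S(ℂ); ℂ)` with Gram matrix `G` (the Hodge-free clauses (C), (D) of
  `marking_of_latticeBasis`, for an arbitrary index type);
* `twoSelfSimilar_of_invariants` — for a smooth projective surface `S` with a `ℤ`-orientation of
  `S(ℂ)` for which `dim_ℂ H²(S(ℂ); ℂ) = 22`, `⟨a ∪ a, [S(ℂ)]⟩` is even and the intersection form
  has index `−16`, there is such a `Ξ`: Milnor's theorem (the tree's
  `exists_latticeBasis_of_isEven_of_signature`) gives a basis with Gram matrix `Λ_{K3}`, and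
  `Ξ = η⁻¹ M η` for the lattice `2`-similitude `M` (`exists_twoSimilitude_k3Lattice`).

Everything is proved; no named fact is introduced. Prover seat prover-pitem-stmt-HodgeConjecture-13681-2.
-/

noncomputable section

namespace Summit.HodgeConjecture.HodgeConjecture.Theorems.NikulinTwinTransport

open CategoryTheory Module
open Literature.AlgebraicGeometry Literature.AlgebraicGeometry.Motives
open Literature.AlgebraicGeometry.HodgeTheory Literature.AlgebraicGeometry.Surfaces
open Literature.AlgebraicTopology.SingularHomology Literature.Topology.FourManifolds

variable {S : SchemeOver ℂ}

/-- **The marking clauses from an integral basis with Gram matrix `G`.** For `S` smooth projective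
of dimension `2`, a `ℤ`-orientation `μ` of `S(ℂ)` and classes `e i ∈ H²(S(ℂ); ℤ)` (`i : ι`) whose
images `e i ⊗ 1` form a `ℂ`-basis of `H²(S(ℂ); ℂ)` containing the image of `H²(S(ℂ); ℤ)` in its
`ℤ`-span, with `⟨e i ∪ e j, [S(ℂ)]_μ⟩ = G i j`: the coordinate isomorphism `η` of that basis and
`p = g ⊗ 1` (`g` the Kronecker dual of the fundamental class) satisfy `p ≠ 0`, `p` integral and
generating the integral classes of `H⁴`, integral classes of `H²` `= η⁻¹(ℤ^ι)`, and
`a ∪ b = ((ηa)ᵀ G (ηb)) • p` — clauses (C), (D) of `marking_of_latticeBasis`, verbatim, for an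
arbitrary index type and Gram matrix. [cite: Huybrechts2016K3, Ch. 1 Prop. 3.5 (p. 24)]
[cite: HatcherAT2002, §3.1 Thm. 3.2 and p. 198; §3.3 Thm. 3.30] -/
theorem integralMarking_of_basis (hS : IsSmoothProjective 2 S)
    (μ : HomologicalOrientation ℤ (ComplexPoints S) (2 * 2))
    {ι : Type} [Fintype ι] [DecidableEq ι]
    (e : ι → singularCohomology ℤ ℤ (ComplexPoints S) (2 * 1)) (G : Matrix ι ι ℤ)
    (hli : LinearIndependent ℂ fun i => (singularCohomology.ringChange (algebraMap ℤ ℂ) (ComplexPoints S) (2 * 1)) (e i))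
    (hsp : ⊤ ≤ Submodule.span ℂ (Set.range fun i => (singularCohomology.ringChange (algebraMap ℤ ℂ) (ComplexPoints S) (2 * 1)) (e i)))
    (hlat : ∀ y : singularCohomology ℤ ℤ (ComplexPoints S) (2 * 1),
      ∃ v : ι → ℤ, (singularCohomology.ringChange (algebraMap ℤ ℂ) (ComplexPoints S) (2 * 1)) y =
        ∑ i, (v i : ℂ) • (singularCohomology.ringChange (algebraMap ℤ ℂ) (ComplexPoints S) (2 * 1)) (e i))
    (hGram : ∀ i j, kroneckerPairing ℤ ℤ (ComplexPoints S) (2 * 2)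
      (cupProduct (rfl : 2 * 1 + 2 * 1 = 2 * 2) (e i) (e j)) μ.fundamentalClass = G i j) :
    ∃ (η : complexBetti S (2 * 1) ≃ₗ[ℂ] (ι → ℂ)) (p : complexBetti S (2 * 2)),
      p ≠ 0 ∧ IsIntegralClass p ∧
      (∀ q : complexBetti S (2 * 2), IsIntegralClass q → ∃ m : ℤ, q = m • p) ∧
      (∀ c : complexBetti S (2 * 1), IsIntegralClass c ↔ ∃ v : ι → ℤ, η c = fun i => (v i : ℂ)) ∧
      ∀ a b : complexBetti S (2 * 1),
        cupProduct (rfl : 2 * 1 + 2 * 1 = 2 * 2) a b =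
          Matrix.toBilin' (G.map (Int.cast : ℤ → ℂ)) (η a) (η b) • p := by
  -- the integral generator `g` of `H⁴(S(ℂ); ℤ)` dual to `[S(ℂ)]_μ`, and `p = g ⊗ 1`
  obtain ⟨g, -, hgenZ, hne, hint, hgenC⟩ := exists_integral_orientation_generator_top hS μ
  -- the basis `b i = e i ⊗ 1` of `H²(S(ℂ); ℂ)` and the coordinate isomorphism `η`
  obtain ⟨b, hb⟩ : ∃ b : Module.Basis ι ℂ (complexBetti S (2 * 1)),
      ∀ i, b i = (singularCohomology.ringChange (algebraMap ℤ ℂ) (ComplexPoints S) (2 * 1)) (e i) :=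
    ⟨Module.Basis.mk hli hsp, fun i => Module.Basis.mk_apply hli hsp i⟩
  obtain ⟨η, hηsymm, hηb⟩ : ∃ η : complexBetti S (2 * 1) ≃ₗ[ℂ] (ι → ℂ),
      (∀ w : ι → ℂ, η.symm w = ∑ i, w i • b i) ∧ ∀ i, η (b i) = Pi.single i 1 :=
    ⟨b.equivFun, fun w => b.equivFun_symm_apply w, fun i => by
      rw [Module.Basis.equivFun_apply, Module.Basis.repr_self, Finsupp.single_eq_pi_single]⟩
  -- integral coordinate vectors
  have hηint : ∀ v : ι → ℤ, η.symm (fun i => (v i : ℂ)) =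
      (singularCohomology.ringChange (algebraMap ℤ ℂ) (ComplexPoints S) (2 * 1)) (∑ i, v i • e i) :=
    fun v => by
    rw [hηsymm, map_sum]
    exact Finset.sum_congr rfl fun i _ => by rw [hb, map_zsmul, Int.cast_smul_eq_zsmul]
  have hηlat : ∀ y : singularCohomology ℤ ℤ (ComplexPoints S) (2 * 1),
      ∃ v : ι → ℤ, η ((singularCohomology.ringChange (algebraMap ℤ ℂ) (ComplexPoints S) (2 * 1)) y) =
        fun i => (v i : ℂ) := fun y => by
    obtain ⟨v, hv⟩ := hlat y
    refine ⟨v, ?_⟩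
    have : (singularCohomology.ringChange (algebraMap ℤ ℂ) (ComplexPoints S) (2 * 1)) y =
        η.symm (fun i => (v i : ℂ)) := by
      rw [hv, hηsymm]; exact Finset.sum_congr rfl fun i _ => by rw [hb]
    rw [this, LinearEquiv.apply_symm_apply]
  -- (C) integral classes are the classes with integral coordinates
  have hC : ∀ c : complexBetti S (2 * 1),
      IsIntegralClass c ↔ ∃ v : ι → ℤ, η c = fun i => (v i : ℂ) := by
    intro c
    constructor
    · intro hc
      obtain ⟨y, rfl⟩ := hc.exists_ringChange_int_eq
      exact hηlat y
    · rintro ⟨v, hv⟩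
      have : c = η.symm (fun i => (v i : ℂ)) := by rw [← hv, LinearEquiv.symm_apply_apply]
      rw [this, hηint]
      exact isIntegralClass_ringChange_int _
  -- cup products of basis vectors: `b i ∪ b j = (e i ∪ e j) ⊗ 1 = G i j • p`
  have hcupb : ∀ i j, cupProduct (rfl : 2 * 1 + 2 * 1 = 2 * 2) (b i) (b j) =
      (G i j : ℂ) • (singularCohomology.ringChange (algebraMap ℤ ℂ) (ComplexPoints S) (2 * 2)) g :=
    fun i j => by
    rw [hb, hb, ← singularCohomology.ringChange_cupProduct (algebraMap ℤ ℂ) rfl (e i) (e j),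
      hgenZ (cupProduct rfl (e i) (e j)), hGram i j, map_zsmul, Int.cast_smul_eq_zsmul]
  -- (D) the cup product is the Gram form in coordinates, times `p` (bilinear extension)
  set Gc : Matrix ι ι ℂ := G.map (Int.cast : ℤ → ℂ) with hGc
  obtain ⟨B, hB⟩ : ∃ B : complexBetti S (2 * 1) →ₗ[ℂ] complexBetti S (2 * 1) →ₗ[ℂ]
      complexBetti S (2 * 2), ∀ a c, B a c =
        Matrix.toBilin' Gc (η a) (η c) • (singularCohomology.ringChange (algebraMap ℤ ℂ) (ComplexPoints S) (2 * 2)) g :=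
    ⟨LinearMap.mk₂ ℂ (fun a c => Matrix.toBilin' Gc (η a) (η c) •
          (singularCohomology.ringChange (algebraMap ℤ ℂ) (ComplexPoints S) (2 * 2)) g)
        (fun a a' c => by rw [map_add, map_add, LinearMap.add_apply, add_smul])
        (fun t a c => by rw [map_smul, map_smul, LinearMap.smul_apply, smul_eq_mul, mul_smul])
        (fun a c c' => by rw [map_add, map_add, add_smul])
        (fun t a c => by rw [map_smul, map_smul, smul_eq_mul, mul_smul]),
      fun a c => rfl⟩
  have hBeq : cupProduct (rfl : 2 * 1 + 2 * 1 = 2 * 2) = B :=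
    b.ext fun i => b.ext fun j => by
      rw [hB, hcupb, hηb, hηb, Matrix.toBilin'_single, hGc, Matrix.map_apply]
  have hD : ∀ a c : complexBetti S (2 * 1), cupProduct (rfl : 2 * 1 + 2 * 1 = 2 * 2) a c =
      Matrix.toBilin' Gc (η a) (η c) • (singularCohomology.ringChange (algebraMap ℤ ℂ) (ComplexPoints S) (2 * 2)) g :=
    fun a c => by rw [hBeq, hB]
  exact ⟨η, _, hne, hint, hgenC, hC, hD⟩

/-- **`H²(S, ℚ)(2) ≅ H²(S, ℚ)` from `b₂ = 22`, evenness and index `−16`** (Huybrechts Ch. 1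
Prop. 3.5 and its printed proof, p. 24: "it is enough to prove that `H²(X, ℤ)` is even of signature
`(3, 19)` … `b₂(X) = 22`"). For `S` smooth projective of dimension `2` and a `ℤ`-orientation `μ` of
`S(ℂ)` with `dim_ℂ H²(S(ℂ); ℂ) = 22`, `⟨a ∪ a, [S(ℂ)]_μ⟩` even for every integral `a`, and
intersection form of index `−16`, there is a `ℂ`-linear `Ξ` of `H²(S(ℂ); ℂ)` preserving rational
classes with `(Ξx ∪ Ξy) = 2 (x ∪ y)`: by Milnor's theorem (the tree's
`exists_latticeBasis_of_isEven_of_signature`) `H²(S(ℂ); ℤ)/T ≅ Λ_{K3}`, whence a marking `η` with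
`a ∪ b = (ηa.ηb) p` (`integralMarking_of_basis`), and `Ξ = η⁻¹ M η` for the lattice `2`-similitude
`M` of `Λ_{K3}` (`exists_twoSimilitude_k3Lattice`: `U(2) ↪ U`, `E₈(2) ↪ E₈`). No Hodge datum,
period point or positivity statement enters: the hypothesis `K3TwoSelfSimilar` of the marking-free
glue rests on the three numerical invariants alone (Noether, Wu, Thom–Hirzebruch).
[cite: Huybrechts2016K3, Ch. 1 Prop. 3.5 and its proof (p. 24); Ch. 14 Cor. 1.3 (i)]
[cite: Morrison1984, §5] -/
theorem twoSelfSimilar_of_invariants (hS : IsSmoothProjective 2 S)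
    (μ : HomologicalOrientation ℤ (ComplexPoints S) (2 * 2))
    (hb2 : Module.finrank ℂ (complexBetti S (2 * 1)) = 22)
    (heven : ∀ a : singularCohomology ℤ ℤ (ComplexPoints S) (2 * 1),
      Even (kroneckerPairing ℤ ℤ (ComplexPoints S) (2 * 2)
        (cupProduct (rfl : 2 * 1 + 2 * 1 = 2 * 2) a a) μ.fundamentalClass))
    (hsig : (intersectionForm (rfl : 2 * 1 + 2 * 1 = 2 * 2) μ).signature = -16) :
    ∃ Ξ : complexBetti S (2 * 1) →ₗ[ℂ] complexBetti S (2 * 1),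
      (∀ x, IsRationalClass x → IsRationalClass (Ξ x)) ∧
      ∀ x y : complexBetti S (2 * 1), cupProduct (rfl : 2 * 1 + 2 * 1 = 2 * 2) (Ξ x) (Ξ y) =
        (2 : ℂ) • cupProduct (rfl : 2 * 1 + 2 * 1 = 2 * 2) x y := by
  have heven' : (intersectionForm (rfl : 2 * 1 + 2 * 1 = 2 * 2) μ).IsEven := fun x => by
    induction x using freeCohomology.induction_on with
    | h a => rw [intersectionForm_mk_mk, cupPairing_apply]; exact heven a
  obtain ⟨e, hli, hsp, hlat, hGram⟩ := exists_latticeBasis_of_isEven_of_signature hS μ hb2 heven' hsig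
  obtain ⟨η, p, -, -, -, hηint, hηcup⟩ := integralMarking_of_basis hS μ e k3Gram hli hsp hlat hGram
  have hηcup' : ∀ a b : complexBetti S (2 * 1),
      cupProduct (rfl : 2 * 1 + 2 * 1 = 2 * 2) a b = k3Form (η a) (η b) • p := fun a b => by
    rw [hηcup, ← k3FormC_apply]; rfl
  obtain ⟨M, N, hMrat, -, -, -, hM2⟩ := exists_twoSimilitude_k3Lattice
  obtain ⟨τ, hτ⟩ := exists_ratEnd_of_forall_intCast M hMrat
  refine ⟨η.symm.toLinearMap ∘ₗ M ∘ₗ η.toLinearMap, fun x hx => ?_, fun x y => ?_⟩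
  · obtain ⟨w, hw⟩ := (isRationalClass_iff_of_integralMarking hS η hηint x).1 hx
    refine (isRationalClass_iff_of_integralMarking hS η hηint _).2 ⟨τ w, ?_⟩
    simp only [LinearMap.coe_comp, LinearEquiv.coe_coe, Function.comp_apply, hw, hτ w,
      LinearEquiv.apply_symm_apply]
  · simp only [LinearMap.coe_comp, LinearEquiv.coe_coe, Function.comp_apply]
    rw [hηcup', hηcup', LinearEquiv.apply_symm_apply, LinearEquiv.apply_symm_apply, hM2, smul_smul]

end Summit.HodgeConjecture.HodgeConjecture.Theorems.NikulinTwinTransport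

end
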